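/-
Origin: expansion seat `planner-pub-hodgecm-toy-g2-0`, handover #22 2026-08-18T08:42:23Z (`HOME/pub-hodgecm-toy-g2/lean/ToyG2/RadicalFree.lean`, md5 794928cb, 161 lines);
landed by the gen-7 packager in gate run 27 as `HodgeCM/Model/ToyG2/RadicalFree.lean` (import ^import ToyG2\.→import HodgeCM.Model.ToyG2. ×1).
-/
/-
# HodgeCM.Model.ToyG2.RadicalFree — nonvanishing traces, block-free radicals, `RadKilled` for block-free targets

Generation 2 of the `pub-hodgecm-toy` lineage (seat `planner-pub-hodgecm-toy-g2-0`), DESIGN.md §9 (G1, abelian case,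
and the perfectness bridge needed by CLAIM A of the general case).

* `trOf_sdeg_ne_zero` : the trace of a GOOD object in its structural degree is nonzero (atoms: orientation;
  good blocks: `ℓ ≠ 0`; products: Künneth on split families);
* `leftRad_eq_bot_of_isBlockFree` : for a block-free object ("abelian variety") the trace pairing
  `⋀^i × ⋀^j → ℚ`, `i + j = 2 dim`, is perfect — its left radical is `⊥`.  Bridge: the trace in top degree is a
  nonzero multiple of the volume coordinate `HodgeCM.Toy.Star.lam`, whose wedge pairing is perfect
  (`HodgeCM.Toy.Star.W_flip_bijective`, tree file `Model/Toy/StarDual.lean`, + `LinearMap.IsPerfPair`);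
* `subsingleton_extPow_of_finrank_lt` : `⋀^k V = 0` for `k > dim V`;
* **`radKilled_of_isBlockFree`** : `RadKilled S X f` whenever the target `X` is block-free (G1, abelian case).
-/
import Mathlib
import Summits.HodgeConjecture.HodgeCM.Model.ToyG2.TrTypeProd
import Summits.HodgeConjecture.HodgeCM.Model.Toy.StarDual

namespace HodgeCM.ToyG2

open HodgeCM.Toy HodgeCM.Toy.CMPresentation
open Literature.AlgebraicGeometry.Motives
open scoped TensorProduct
open exteriorPower Obj₂

noncomputable section

/-! ### §1 Nonvanishing of the structural form of a good object -/

/-- (Ported verbatim from the HodgeCMPerL package; no docstring in the source.) -/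
lemma AlternatingMap.exists_ne_zero_of_ne_zero {R M N ι : Type*} [CommRing R] [AddCommGroup M] [Module R M]
    [AddCommGroup N] [Module R N] {α : M [⋀^ι]→ₗ[R] N} (h : α ≠ 0) : ∃ v, α v ≠ 0 := by
  by_contra h'
  push Not at h'
  exact h (AlternatingMap.ext fun v => (h' v).trans (AlternatingMap.zero_apply v).symm)

/-- (Ported verbatim from the HodgeCMPerL package; no docstring in the source.) -/
lemma prodForm_ne_zero {A B : Obj} {m n : ℕ} {α : A.L [⋀^Fin m]→ₗ[ℚ] ℚ} {β : B.L [⋀^Fin n]→ₗ[ℚ] ℚ}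
    (hα : α ≠ 0) (hβ : β ≠ 0) : prodForm α β ≠ 0 := by
  obtain ⟨x, hx⟩ := AlternatingMap.exists_ne_zero_of_ne_zero hα
  obtain ⟨y, hy⟩ := AlternatingMap.exists_ne_zero_of_ne_zero hβ
  intro h0
  have h := prodForm_append α β x y
  rw [h0, AlternatingMap.zero_apply] at h
  exact mul_ne_zero hx hy h.symm

/-- (Ported verbatim from the HodgeCMPerL package; no docstring in the source.) -/
lemma Leaf.form_ne_zero_of_good : ∀ (lf : Leaf), lf.Good → lf.form ≠ 0
  | .atom a, _ => form_atom_ne_zero a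
  | .pb p, h => by
      intro h0
      apply h.1
      refine exteriorPower.linearMap_ext ?_
      rw [LinearMap.zero_compAlternatingMap]
      exact h0

/-- (Ported verbatim from the HodgeCMPerL package; no docstring in the source.) -/
lemma sform_ne_zero : ∀ (s : Shape) (l : s.toType → Leaf), (∀ u, (l u).Good) → sform s l ≠ 0
  | .empty, _, _ => by
      intro h0
      have h := congrArg (fun f => f Fin.elim0) h0
      simp only [sform, AlternatingMap.zero_apply] at h
      exact one_ne_zero h
  | .unit, l, h => Leaf.form_ne_zero_of_good (l ()) (h ())
  | .sum a b, l, h => prodForm_ne_zero (sform_ne_zero a _ fun u => h (Sum.inl u))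
      (sform_ne_zero b _ fun u => h (Sum.inr u))

/-- **the trace of a good object in degree `2 dim` is nonzero** -/
theorem trOf_sdeg_ne_zero {X : Obj₂} (h : X.Good) : trOf X (sdeg X.s X.leaf) ≠ 0 := by
  intro h0
  apply sform_ne_zero X.s X.leaf h
  refine AlternatingMap.ext fun v => ?_
  have hv : (v ∘ ⇑(finCongr (rfl : sdeg X.s X.leaf = sdeg X.s X.leaf))) = v :=
    funext fun i => congrArg v (Fin.ext rfl)
  have h1 := trOf_apply_ιMulti (X := X) rfl v
  rw [h0, LinearMap.zero_apply, hv] at h1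
  exact h1.symm

/-- block-free objects are good -/
lemma good_of_isBlockFree {X : Obj₂} (hX : X.IsBlockFree) : X.Good := by
  intro u
  have hu := hX u
  revert hu
  cases X.leaf u with
  | atom a => exact fun _ => trivial
  | pb p => exact fun hu => absurd (Leaf.isPB_pb p) hu

/-! ### §2 Block-free radicals are trivial -/

/-- a functional on the top power is a multiple of the volume coordinate -/
lemma apply_eq_lam_mul {V : Type*} [AddCommGroup V] [Module ℚ V] [FiniteDimensional ℚ V] {k l : ℕ}
    (hV : Module.finrank ℚ V = k + l) (φ : (⋀[ℚ]^(k + l) V) →ₗ[ℚ] ℚ) (z : ⋀[ℚ]^(k + l) V) :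
    φ z = Star.lam hV z * φ (Star.vol hV) := by
  conv_lhs => rw [Star.eq_lam_smul_vol hV z]
  rw [map_smul, smul_eq_mul]

/-- the wedge pairing of a space of dimension `k + l` is perfect in the LEFT slot too -/
lemma Star.W_injective {V : Type*} [AddCommGroup V] [Module ℚ V] [FiniteDimensional ℚ V] {k l : ℕ}
    (hV : Module.finrank ℚ V = k + l) : Function.Injective (Star.W hV) := by
  haveI : (Star.W hV).flip.IsPerfPair :=
    LinearMap.IsPerfPair.of_bijective _ (Star.W_flip_bijective hV)
  have hb := LinearMap.IsPerfPair.bijective_right (Star.W hV).flip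
  rw [LinearMap.flip_flip] at hb
  exact hb.1

/-- **for a block-free object the trace pairing `⋀^i × ⋀^j → ℚ` (`i + j = 2 dim`) has trivial left radical** -/
theorem leftRad_eq_bot_of_isBlockFree {X : Obj₂} (hX : X.IsBlockFree) {i j : ℕ} (hij : i + j = 2 * X.dim) :
    leftRad X i j = ⊥ := by
  have hV : Module.finrank ℚ X.L = i + j := by rw [← two_mul_dim_eq_finrank hX, hij]
  have hsd : sdeg X.s X.leaf = i + j := by rw [sdeg_eq, ← hij]
  have hne : trOf X (i + j) ≠ 0 := by
    have h := trOf_sdeg_ne_zero (good_of_isBlockFree hX)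
    rwa [hsd] at h
  have hvol : trOf X (i + j) (Star.vol hV) ≠ 0 := by
    intro h0
    apply hne
    refine LinearMap.ext fun z => ?_
    rw [apply_eq_lam_mul hV (trOf X (i + j)) z, h0, mul_zero, LinearMap.zero_apply]
  rw [Submodule.eq_bot_iff]
  intro y hy
  apply Star.W_injective hV
  rw [map_zero]
  refine LinearMap.ext fun z => ?_
  have h := (mem_leftRad.1 hy) z
  rw [apply_eq_lam_mul hV (trOf X (i + j))] at h
  rw [Star.W_apply, LinearMap.zero_apply]
  exact (mul_eq_zero.1 h).resolve_right hvol

/-! ### §3 Exterior powers beyond the dimension vanish -/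

/-- (Ported verbatim from the HodgeCMPerL package; no docstring in the source.) -/
lemma subsingleton_extPow_of_finrank_lt {V : Type*} [AddCommGroup V] [Module ℚ V] [FiniteDimensional ℚ V]
    {k : ℕ} (h : Module.finrank ℚ V < k) : Subsingleton (⋀[ℚ]^k V) := by
  haveI : IsEmpty (Set.powersetCard (Fin (Module.finrank ℚ V)) k) := ⟨fun s => by
    have hs : s.val.card = k := s.prop
    have hle : s.val.card ≤ Fintype.card (Fin (Module.finrank ℚ V)) := Finset.card_le_univ _
    rw [Fintype.card_fin, hs] at hle
    omega⟩
  exact ((Module.finBasis ℚ V).exteriorPower k).repr.toEquiv.subsingleton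

/-! ### §4 `RadKilled` for block-free targets -/

/-- **G1, abelian case: an admissible pull-back to a surface kills the radical of a block-free target**
(because that radical is trivial, or `⋀⁴ H¹ = 0` for targets of dimension `≤ 1`) -/
theorem radKilled_of_isBlockFree {S X : Obj₂} (hX : X.IsBlockFree) (f : Hom₂ S X) : RadKilled S X f := by
  intro y hy
  by_cases h2 : 2 ≤ X.dim
  · have hij : 4 + 2 * (X.dim - 2) = 2 * X.dim := by omega
    rw [leftRad_eq_bot_of_isBlockFree hX hij, Submodule.mem_bot] at hy
    rw [hy, map_zero, map_zero]
  · have hlt : Module.finrank ℚ X.L < 4 := by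
      rw [← two_mul_dim_eq_finrank hX]
      omega
    haveI := subsingleton_extPow_of_finrank_lt hlt
    rw [Subsingleton.elim y 0, map_zero, map_zero]

/-- hence, for the all-block-free sub-universe, `M26` needs only `HodgeRiesz` … (recorded for gen 3:
the general `RadKilled` is CLAIM A + CLAIM B of DESIGN.md §9) -/
theorem radKilled_cmObj₂ {S : Obj₂} (K : CMField) (Φ : CMType K) (f : Hom₂ S (cmObj₂ K Φ)) :
    RadKilled S (cmObj₂ K Φ) f :=
  radKilled_of_isBlockFree (isBlockFree_cmObj₂ K Φ) f

end

end HodgeCM.ToyG2
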